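import Summits.CriticalPhenomena.PercolationContinuityZ3.Theorems.PercNearOneGluingNoHeavyLowerTailSunflowerMultiPetalLocalMatching
import HarnessLib
import HarnessLib.Audit

/-!
# `NoHeavyLowerTail` (crux stmt-CriticalPhenomena-4575), abstract sunflower cubic, `k` petals: the RECTANGLE form of the
# doubled-cube Hall conjecture — `DoubledCubeHallK ⟹ RectangleCountK ⟹ PartitionLemmaK`

Support file (seat `prim-l12-p2` gen 29; `--supports stmt-CriticalPhenomena-4575`; companion of
`…SunflowerMultiPetalLocalMatching` (p344154: `slotParts`, `badParts`, `ZK_eq_slot`, `DCAdj`, `@[conjecture] DoubledCubeHallK`,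
`partitionLemmaK_of_doubledCubeHallK`) and `…SunflowerMultiPetal` (p338110: `MSunflower`, `ZK`, `PartitionLemmaK`)).  No `sorry`;
the `@[conjecture]` definition below is an obligation of the programme, never a fact.
Memo: run/shared/lean/prim/prim-l12/prim-l12-p2/FINDING-g29-RECTANGLE-REDUCTION.md.

SETTING (memo §1).  A bad ordered partition `q` (`badParts`: pairwise distinct labels, at most one decided) has a unique ORIENTED PAIR
of blocks `(P, P')`: its two petal blocks of smallest labels, `lab P < lab P'` (`MSunflower.Orient`, uniqueness `orient_unique`); the
doubled-cube adjacency `DCAdj q s` of p344154 says exactly `P ⊆ S` and `T ⊆ P'` for the slot `s = (K, S, T)`.  So the neighbourhood of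
a demand in the Hall problem `DoubledCubeHallK` is the set of slots in the 'principal rectangle' `↑P × ↓P'` of the product poset
(top blocks ordered by `⊆`, bottom blocks by `⊇`), and Hall's condition restricted to RECTANGLES `𝒱 × 𝒟` (`𝒱` an up-set of
candidate top blocks, `𝒟` a down-set of candidate bottom blocks) is the COUNTING statement

* `RectangleCountK` (this work, OPEN):  `#{bad q : P ∈ 𝒱, P' ∈ 𝒟} ≤ 6 · #{slots (K,S,T) : S ∈ 𝒱, T ∈ 𝒟}`
  for every up-set `𝒱` and down-set `𝒟` of `Finset α` — for `𝒱 = 𝒟 = univ` it is literally `PartitionLemmaK` (slot form `ZK_eq_slot`).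

* `rectangleCountK_of_doubledCubeHallK` : the easy direction (an injective adjacency-respecting assignment maps the demands of a rectangle
  to distinct slots of the same rectangle, because `𝒱` is an up-set and `𝒟` a down-set).
* `partitionLemmaK_of_rectangleCountK` : `𝒱 = 𝒟 = univ`.

CENSUS (memo §2; exact integer engines, this seat): the minimum Hall surplus `min_{X ≠ ∅} (|N(X)| − |X|)` of the doubled-cube bipartite
graph EQUALS the minimum rectangle surplus `min_{(𝒱,𝒟)} (#slots − #demands)` for EVERY `(A,B)` pair on ≤ 4 points (2 966 instances with
demands), for all sampled / adversarially searched instances on 5 and 6 points (≈ 6·10⁴, all orders of the components), and the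
minimal Hall-critical demand set is itself 'rectangular' (its rectangular hull contains no further slot or demand) in every case — i.e.
conjecturally `DoubledCubeHallK ⟺ RectangleCountK`; the exhaustive 5-point census is kit job j184562 (evidence on the item).  Two natural
STRONGER Hall structures are FALSE: the 'Λ-order' (slot spectator carved out of the demand's third block, `K ⊆ X`) fails on 6 points and the
'V-order' (`X ⊆ K`) on 4 points (memo §3).
-/

namespace Summit.CriticalPhenomena.PercolationContinuityZ3.Theorems.SunflowerPartition

open Finset

namespace MSunflower

variable {α : Type*} [DecidableEq α] [Fintype α] {k : ℕ} (F : MSunflower k α)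

/-- `P` is one of the three blocks of the ordered partition coded `q = (X, Y)` (third block `(X ∪ Y)ᶜ`). [this work] -/
def IsBlock (q : Finset α × Finset α) (P : Finset α) : Prop := P = q.1 ∨ P = q.2 ∨ P = (q.1 ∪ q.2)ᶜ

/-- `P` carries a petal label (neither top nor bottom). [this work] -/
def IsPetal (P : Finset α) : Prop := ¬ (F.lab P = Fin.last (k + 1) ∨ F.lab P = 0)

/-- The ORIENTATION of a bad ordered partition: `(P, P')` are blocks of `q` with petal labels, `lab P < lab P'`, and every other petal
block of `q` has a label above `lab P'` (so `P, P'` are the petal blocks of least and second-least label).  These are exactly the first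
six conjuncts of `DCAdj`. [this work] -/
def Orient (q : Finset α × Finset α) (P P' : Finset α) : Prop :=
  IsBlock q P ∧ IsBlock q P' ∧ F.IsPetal P ∧ F.IsPetal P' ∧ F.lab P < F.lab P' ∧
    ∀ P'' : Finset α, IsBlock q P'' → F.IsPetal P'' → P'' ≠ P → P'' ≠ P' → F.lab P' < F.lab P''

/-- `DCAdj` unfolded through `Orient`: the slot `s = (K, S, T)` lies above `q` iff `P ⊆ S` and `T ⊆ P'` for some orientation `(P, P')`
of `q`. [this work] -/
theorem dcAdj_iff (q s : Finset α × Finset α) :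
    F.DCAdj q s ↔ ∃ P P', F.Orient q P P' ∧ P ⊆ s.2 ∧ (s.1 ∪ s.2)ᶜ ⊆ P' := by
  unfold DCAdj Orient IsBlock IsPetal
  constructor
  · rintro ⟨P, P', hP, hP', hp, hp', hlt, hmin, hS, hT⟩
    exact ⟨P, P', ⟨hP, hP', hp, hp', hlt, hmin⟩, hS, hT⟩
  · rintro ⟨P, P', ⟨hP, hP', hp, hp', hlt, hmin⟩, hS, hT⟩
    exact ⟨P, P', hP, hP', hp, hp', hlt, hmin, hS, hT⟩

/-- **Uniqueness of the orientation** of an ordered partition. [this work] -/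
theorem orient_unique {q : Finset α × Finset α} {P P' R R' : Finset α} (h₁ : F.Orient q P P') (h₂ : F.Orient q R R') :
    P = R ∧ P' = R' := by
  obtain ⟨hP, hP', hp, hp', hlt, hmin⟩ := h₁
  obtain ⟨hR, hR', hr, hr', hlt', hmin'⟩ := h₂
  have hPR : P = R := by
    by_contra hne
    by_cases hPR' : P = R'
    · -- P = R' : then lab R < lab R' = lab P < lab P'; R ≠ P, and R = P' is impossible, so lab P' < lab R: cycle
      subst hPR'
      have hRP' : R ≠ P' := fun h => by subst h; exact lt_asymm hlt hlt'
      have h3 : F.lab P' < F.lab R := hmin R hR hr (Ne.symm hne) hRP'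
      exact lt_irrefl _ (lt_trans (lt_trans hlt h3) hlt')
    · -- P ∉ {R, R'} : lab R' < lab P (by h₂'s minimality) and lab P' < ... 
      have h4 : F.lab R' < F.lab P := hmin' P hP hp hne hPR'
      by_cases hRP' : R = P'
      · subst hRP'; exact lt_irrefl _ (lt_trans (lt_trans hlt hlt') h4)
      · have h3 : F.lab P' < F.lab R := hmin R hR hr (Ne.symm hne) hRP'
        exact lt_irrefl _ (lt_trans (lt_trans (lt_trans hlt h3) hlt') h4)
  subst hPR
  refine ⟨rfl, ?_⟩
  by_contra hne'
  have hR'P : R' ≠ P := fun h => by subst h; exact lt_irrefl _ hlt'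
  have hP'P : P' ≠ P := fun h => by subst h; exact lt_irrefl _ hlt
  have h3 : F.lab P' < F.lab R' := hmin R' hR' hr' hR'P (Ne.symm hne')
  have h4 : F.lab R' < F.lab P' := hmin' P' hP' hp' hP'P hne'
  exact lt_irrefl _ (lt_trans h3 h4)

/-- Constructor for `Orient`: two petal blocks in label order and a third block that is decided or has a larger label. [this work] -/
theorem orient_intro {q : Finset α × Finset α} {P P' P₃ : Finset α} (hP : IsBlock q P) (hP' : IsBlock q P')
    (hcov : ∀ R, IsBlock q R → R = P ∨ R = P' ∨ R = P₃) (hp : F.IsPetal P) (hp' : F.IsPetal P') (hlt : F.lab P < F.lab P')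
    (h3 : F.IsPetal P₃ → F.lab P' < F.lab P₃) : F.Orient q P P' := by
  refine ⟨hP, hP', hp, hp', hlt, fun R hR hr hne hne' => ?_⟩
  rcases hcov R hR with rfl | rfl | rfl
  · exact absurd rfl hne
  · exact absurd rfl hne'
  · exact h3 hr

/-- **Existence of the orientation** for every bad ordered partition (pairwise distinct labels, at most one decided block). [this work] -/
theorem orient_exists {q : Finset α × Finset α} (hq : q ∈ F.badParts) : ∃ P P', F.Orient q P P' := by
  obtain ⟨-, ⟨hxy, hyz, hxz⟩, hdec⟩ := Finset.mem_filter.1 hq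
  have bX : IsBlock q q.1 := Or.inl rfl
  have bY : IsBlock q q.2 := Or.inr (Or.inl rfl)
  have bW : IsBlock q (q.1 ∪ q.2)ᶜ := Or.inr (Or.inr rfl)
  have cov : ∀ R, IsBlock q R → R = q.1 ∨ R = q.2 ∨ R = (q.1 ∪ q.2)ᶜ := fun R hR => hR
  by_cases pX : F.IsPetal q.1 <;> by_cases pY : F.IsPetal q.2 <;> by_cases pW : F.IsPetal (q.1 ∪ q.2)ᶜ
  · -- three petal blocks: sort the labels
    rcases lt_or_gt_of_ne hxy with h12 | h21
    · rcases lt_or_gt_of_ne hyz with h23 | h32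
      · exact ⟨_, _, F.orient_intro bX bY cov pX pY h12 (fun _ => h23)⟩
      · rcases lt_or_gt_of_ne hxz with h13 | h31
        · exact ⟨_, _, F.orient_intro bX bW (fun R hR => by rcases cov R hR with h | h | h <;> simp [h]) pX pW h13 (fun _ => h32)⟩
        · exact ⟨_, _, F.orient_intro bW bX (fun R hR => by rcases cov R hR with h | h | h <;> simp [h]) pW pX h31 (fun _ => h12)⟩
    · rcases lt_or_gt_of_ne hxz with h13 | h31
      · exact ⟨_, _, F.orient_intro bY bX (fun R hR => by rcases cov R hR with h | h | h <;> simp [h]) pY pX h21 (fun _ => h13)⟩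
      · rcases lt_or_gt_of_ne hyz with h23 | h32
        · exact ⟨_, _, F.orient_intro bY bW (fun R hR => by rcases cov R hR with h | h | h <;> simp [h]) pY pW h23 (fun _ => h31)⟩
        · exact ⟨_, _, F.orient_intro bW bY (fun R hR => by rcases cov R hR with h | h | h <;> simp [h]) pW pY h32 (fun _ => h21)⟩
  · -- X, Y petal, W decided
    rcases lt_or_gt_of_ne hxy with h12 | h21
    · exact ⟨_, _, F.orient_intro bX bY cov pX pY h12 (fun h => absurd h pW)⟩
    · exact ⟨_, _, F.orient_intro bY bX (fun R hR => by rcases cov R hR with h | h | h <;> simp [h]) pY pX h21 (fun h => absurd h pW)⟩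
  · -- X, W petal, Y decided
    rcases lt_or_gt_of_ne hxz with h13 | h31
    · exact ⟨_, _, F.orient_intro bX bW (fun R hR => by rcases cov R hR with h | h | h <;> simp [h]) pX pW h13 (fun h => absurd h pY)⟩
    · exact ⟨_, _, F.orient_intro bW bX (fun R hR => by rcases cov R hR with h | h | h <;> simp [h]) pW pX h31 (fun h => absurd h pY)⟩
  · -- X petal only: two decided blocks, contradiction
    exact absurd (Or.inr (Or.inr ⟨not_not.1 pY, not_not.1 pW⟩)) hdec
  · -- Y, W petal, X decided
    rcases lt_or_gt_of_ne hyz with h23 | h32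
    · exact ⟨_, _, F.orient_intro bY bW (fun R hR => by rcases cov R hR with h | h | h <;> simp [h]) pY pW h23 (fun h => absurd h pX)⟩
    · exact ⟨_, _, F.orient_intro bW bY (fun R hR => by rcases cov R hR with h | h | h <;> simp [h]) pW pY h32 (fun h => absurd h pX)⟩
  · exact absurd (Or.inr (Or.inl ⟨not_not.1 pX, not_not.1 pW⟩)) hdec
  · exact absurd (Or.inl ⟨not_not.1 pX, not_not.1 pY⟩) hdec
  · exact absurd (Or.inl ⟨not_not.1 pX, not_not.1 pY⟩) hdec

/-- A bad ordered partition lies in the RECTANGLE `𝒱 × 𝒟` if its orientation `(P, P')` (unique, `orient_unique`; it exists for every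
member of `badParts`, `orient_exists`) has `P ∈ 𝒱` and `P' ∈ 𝒟`. [this work] -/
def InRect (𝒱 𝒟 : Finset (Finset α)) (q : Finset α × Finset α) : Prop := ∀ P P', F.Orient q P P' → P ∈ 𝒱 ∧ P' ∈ 𝒟

/-- For a partition with an orientation `(P, P')`, membership in the rectangle means `P ∈ 𝒱 ∧ P' ∈ 𝒟` (by uniqueness). [this work] -/
theorem inRect_iff_of_orient {𝒱 𝒟 : Finset (Finset α)} {q : Finset α × Finset α} {P P' : Finset α} (h : F.Orient q P P') :
    F.InRect 𝒱 𝒟 q ↔ P ∈ 𝒱 ∧ P' ∈ 𝒟 := by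
  constructor
  · exact fun hq => hq P P' h
  · intro hm R R' hR
    obtain ⟨rfl, rfl⟩ := F.orient_unique h hR
    exact hm

/-- The bad ordered partitions of the rectangle `𝒱 × 𝒟`. [this work] -/
noncomputable def badIn (𝒱 𝒟 : Finset (Finset α)) : Finset (Finset α × Finset α) :=
  @Finset.filter _ (F.InRect 𝒱 𝒟) (Classical.decPred _) F.badParts

/-- The slots `(K, S, T)` of the rectangle: `S ∈ 𝒱`, `T ∈ 𝒟`. [this work] -/
def slotIn (𝒱 𝒟 : Finset (Finset α)) : Finset (Finset α × Finset α) :=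
  F.slotParts.filter fun s => s.2 ∈ 𝒱 ∧ (s.1 ∪ s.2)ᶜ ∈ 𝒟

/-- A slot above a rectangle demand lies in the rectangle (`𝒱` up-closed, `𝒟` down-closed). [this work] -/
theorem slot_mem_rect {𝒱 𝒟 : Finset (Finset α)} (h𝒱 : IsUpperSet (𝒱 : Set (Finset α))) (h𝒟 : IsLowerSet (𝒟 : Set (Finset α)))
    {q s : Finset α × Finset α} (hq : F.InRect 𝒱 𝒟 q) (hadj : F.DCAdj q s) : s.2 ∈ 𝒱 ∧ (s.1 ∪ s.2)ᶜ ∈ 𝒟 := by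
  obtain ⟨R, R', hor', hRS, hTR'⟩ := (F.dcAdj_iff q s).1 hadj
  obtain ⟨hRV, hR'D⟩ := hq R R' hor'
  exact ⟨h𝒱 hRS hRV, h𝒟 hTR' hR'D⟩

end MSunflower

/-- **(RECT) RECTANGLE COUNT CONJECTURE** (this work; OPEN; census in the header and memo §2): for every `k`, every finite `α`, every
monotone map `2^α → M_k` and every up-set `𝒱` / down-set `𝒟` of `Finset α`, the bad ordered partitions oriented into the rectangle
`𝒱 × 𝒟` number at most six times the slots `(K, S, T)` with `S ∈ 𝒱`, `T ∈ 𝒟`.  Hall's condition of `DoubledCubeHallK` restricted to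
rectangles; for `𝒱 = 𝒟 = univ` it is `PartitionLemmaK`.  Empirically the Hall deficiency of the doubled-cube graph is ATTAINED on
rectangles (memo §2), i.e. conjecturally equivalent to `DoubledCubeHallK`.  An obligation, never a fact: use as `(h : RectangleCountK)`.
[status: open] -/
@[conjecture] def RectangleCountK : Prop :=
  ∀ (k : ℕ) (α : Type) [Fintype α] [DecidableEq α] (F : MSunflower k α) (𝒱 𝒟 : Finset (Finset α)),
    IsUpperSet (𝒱 : Set (Finset α)) → IsLowerSet (𝒟 : Set (Finset α)) → (F.badIn 𝒱 𝒟).card ≤ 6 * (F.slotIn 𝒱 𝒟).card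

/-- **(DC) ⟹ (RECT)**: an injective doubled-cube assignment maps the demands of a rectangle to distinct slots (with multiplicity six)
of the same rectangle. [this work] -/
theorem rectangleCountK_of_doubledCubeHallK (h : DoubledCubeHallK) : RectangleCountK := by
  intro k α _ _ F 𝒱 𝒟 h𝒱 h𝒟
  classical
  obtain ⟨ψ, hψ, hadj⟩ := h k α F
  -- restrict ψ to the rectangle
  have hmem : ∀ q : ↥(F.badIn 𝒱 𝒟), (q : Finset α × Finset α) ∈ F.badParts ∧ F.InRect 𝒱 𝒟 (q : Finset α × Finset α) :=
    fun q => (@Finset.mem_filter _ (F.InRect 𝒱 𝒟) (Classical.decPred _) F.badParts q).1 q.2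
  have hsub : ∀ q : ↥(F.badIn 𝒱 𝒟), (q : Finset α × Finset α) ∈ F.badParts := fun q => (hmem q).1
  have hin : ∀ q : ↥(F.badIn 𝒱 𝒟), F.InRect 𝒱 𝒟 (q : Finset α × Finset α) := fun q => (hmem q).2
  let φ : ↥(F.badIn 𝒱 𝒟) → ↥(F.slotIn 𝒱 𝒟) × Fin 6 := fun q =>
    (⟨((ψ ⟨q, hsub q⟩).1 : Finset α × Finset α), by
        have hs := (ψ ⟨q, hsub q⟩).1.2
        have hr := F.slot_mem_rect h𝒱 h𝒟 (hin q) (hadj ⟨q, hsub q⟩)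
        exact (Finset.mem_filter).2 ⟨hs, hr⟩⟩, (ψ ⟨q, hsub q⟩).2)
  have hφ : Function.Injective φ := by
    intro q₁ q₂ he
    have h1 : ((ψ ⟨q₁, hsub q₁⟩).1 : Finset α × Finset α) = (ψ ⟨q₂, hsub q₂⟩).1 := by
      have := congrArg (fun p => ((p.1 : ↥(F.slotIn 𝒱 𝒟)) : Finset α × Finset α)) he
      simpa [φ] using this
    have h2 : (ψ ⟨q₁, hsub q₁⟩).2 = (ψ ⟨q₂, hsub q₂⟩).2 := by
      have := congrArg (fun p => p.2) he; simpa [φ] using this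
    have h3 : ψ ⟨q₁, hsub q₁⟩ = ψ ⟨q₂, hsub q₂⟩ := Prod.ext (Subtype.ext h1) h2
    have h4 := hψ h3
    exact Subtype.ext (by simpa using congrArg Subtype.val h4)
  have hc := Fintype.card_le_of_injective φ hφ
  rw [Fintype.card_prod, Fintype.card_fin, Fintype.card_coe, Fintype.card_coe] at hc
  linarith

/-- **(RECT) ⟹ ★ₖ**: take `𝒱 = 𝒟 = univ`; the rectangle count is `#badParts ≤ 6 · #slotParts`, i.e. `0 ≤ ZK` by the slot form. [this work] -/
theorem partitionLemmaK_of_rectangleCountK (h : RectangleCountK) : PartitionLemmaK := by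
  intro k α _ _ F
  classical
  have hR := h k α F Finset.univ Finset.univ (fun _ _ _ _ => Finset.mem_coe.2 (Finset.mem_univ _))
    (fun _ _ _ _ => Finset.mem_coe.2 (Finset.mem_univ _))
  have hb : F.badIn Finset.univ Finset.univ = F.badParts := by
    ext q
    rw [MSunflower.badIn, @Finset.mem_filter _ (F.InRect Finset.univ Finset.univ) (Classical.decPred _) F.badParts q]
    constructor
    · exact fun hq => hq.1
    · exact fun hq => ⟨hq, fun P P' _ => ⟨Finset.mem_univ _, Finset.mem_univ _⟩⟩
  have hs : F.slotIn Finset.univ Finset.univ = F.slotParts := by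
    ext s; simp [MSunflower.slotIn]
  rw [hb, hs] at hR
  exact (F.ZK_nonneg_iff_card).2 hR

end Summit.CriticalPhenomena.PercolationContinuityZ3.Theorems.SunflowerPartition
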